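import Summits.AtomisticToContinuum.BoseEinsteinCondensation.Theorems.BECCutLineWeakDisorderTwoReplicaTransienceBoundFreeOneTools
import HarnessLib

/-!
# Crux `TwoReplicaTransienceBound` (stmt-AtomisticToContinuum-9687), line `tagged-shift-log-harnack`,
# stub `stub_localCrowdingBridge`: the one-line TWO-TIME density bound (free-gas kernel)

Support file (`--supports stmt-AtomisticToContinuum-9687`; does not close the item, does not prove the
stub). The stub `LocalCrowdingBridge` (`Theorems/BECCutLineWeakDisorderTaggedShiftDefs.lean`) asks for
exponential moments of the number of bath lines near the (displaced) tagged line at a bridge time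
`T + s`, `s ∈ [0, κ/ρ]`, under the `2T`-long flat-datum Feynman–Kac bridge, uniformly in `n` and
`T ≥ κ/ρ`. For the FREE gas the lines are i.i.d. under the bridge, the count is binomial, and everything
reduces to a bound on the one-body density of ONE killed line at the bridge time `t₁ = T + s`, which is
`θ_{t₁}(y) θ_{t₂}(y) / ‖θ_T‖₂²` (`t₂ = T - s`, `θ_t(y) = Z^{(1)}_t(y)` the Dirichlet survival probability,
`‖θ_T‖₂² = fkNormSq` the one-line bridge mass; cut lemma `lintegral_mul_lintegral_fkWeight_mul_mul`).
This file proves that kernel bound, with an ABSOLUTE constant and no spectral input: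

  `L³ · θ_{T+s}(y) · θ_{T-s}(y) ≤ C · ‖θ_T‖₂²`  for all `L > 0`, `0 ≤ s ≤ T`, `2s ≤ L²/960`, `y ∈ ℝ³`

(`fkPartition_one_two_time_mul_le`). The point flagged by the line lead — at `t₁ ≠ t₂` Cauchy–Schwarz
produces `(‖θ_{t₁}‖₂²‖θ_{t₂}‖₂²)^{1/2}`, which log-convexity puts ABOVE `‖θ_T‖₂²` — is settled without the
principal Dirichlet eigenfunction: the log-convexity LADDER `fkNormSq_ladder` with step `h = s` gives
`‖θ_{T-s}‖₂² · ‖θ_{2s}‖₂² ≤ ‖θ_0‖₂² · ‖θ_T‖₂²`, and the survival floor on the middle cube bounds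
`‖θ_{2s}‖₂² ≥ q₀²(L/2)³` as long as the displacement window `2s` is below the box diffusion time `L²/960`
(in the stub `s ≤ κ/ρ` while `L² = ((n+1)/ρ)^{2/3} → ∞`: true for all large `n`). The sup bound at each
single time is the long-time branch of `FreeGas.free_ratio_le` (`fkSemigroup_one_sq_mul_le`: `L² → L^∞`
smoothing over one diffusive step `h₀ = L²/1920` + ladder; short times by `θ ≤ 1` and the floor).

## References

* K. L. Chung, Z. Zhao, *From Brownian Motion to Schrödinger's Equation* (1995), Thm 3.17
  (`T_t : L² → L^∞`). [ChungZhao1995]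
* B. Simon, *Schrödinger semigroups*, Bull. AMS 7 (1982), §A1 (A7) (the flat-datum witnesses and
  their normalising constant). [Simon1982]
-/

noncomputable section

open MeasureTheory Filter Set Metric
open scoped ENNReal NNReal Topology

namespace Summit.AtomisticToContinuum.BoseEinsteinCondensation.Cruxes.TwoReplicaTransienceBound.TaggedShiftLogHarnack

open Literature.MathematicalPhysics.QuantumManyBody.BoseGas
open Summit.AtomisticToContinuum.BoseEinsteinCondensation.Theorems.CutLineWitness
open Summit.AtomisticToContinuum.BoseEinsteinCondensation.Cruxes.TwoReplicaTransienceBound.FreeGas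

/-- **One killed line, two bridge times: `L³ θ_{T+s}(y) θ_{T-s}(y) ≤ C ‖θ_T‖₂²`** with ONE finite constant
`C`, for every (irrelevant, measurable) pair potential `v`, every `L > 0`, `0 ≤ s ≤ T` with `2s ≤ L²/960`,
and every `y ∈ ℝ³` (`θ_t(y) = Z^{(1)}_t(y)` the Dirichlet survival probability of one Brownian line at
speed `2` in `Λ_L`, `‖θ_T‖₂² = fkNormSq`, the mass of the one-line `2T`-bridge, `= ∫θ_{T+s}θ_{T-s}`).
Sup bound at each time by `L² → L^∞` smoothing over one diffusive step and the log-convexity ladder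
(long times) or the survival floor (short times); the mismatch `t₁ ≠ t₂` by the ladder with step `s` and
the floor at `2s`. [cite: ChungZhao1995, Thm 3.17] -/
theorem fkPartition_one_two_time_mul_le : ∃ C : ℝ≥0∞, C ≠ ⊤ ∧ ∀ (v : ℝ → ℝ≥0∞), Measurable v →
    ∀ L : ℝ, 0 < L → ∀ T s : ℝ, 0 ≤ s → s ≤ T → 2 * s ≤ L ^ 2 / 960 → ∀ y : Space,
      ENNReal.ofReal (L ^ 3) * (fkPartition (N := 1) v L (T + s) (fun _ => y) *
          fkPartition (N := 1) v L (T - s) (fun _ => y)) ≤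
        C * fkNormSq (N := 1) v L T (fun _ => (1 : ℝ≥0∞)) := by
  -- the absolute constants
  set q : ℝ := 1 - 6 * Real.exp (-5) with hq
  have hq0 : 0 < q := q0_pos
  set c : ℝ := Real.sqrt (Real.pi / 480) with hc
  have hc0 : 0 < c := Real.sqrt_pos.2 (by positivity)
  set P₀ : ℝ≥0∞ := ENNReal.ofReal (c⁻¹ ^ 3) with hP₀
  set A : ℝ≥0∞ := P₀ + 1 with hA
  set C : ℝ≥0∞ := ENNReal.ofReal (8 / q ^ 2) * (ENNReal.ofReal (3 / q) * A) with hC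
  have hAt : A ≠ ⊤ := ENNReal.add_ne_top.2 ⟨ENNReal.ofReal_ne_top, ENNReal.one_ne_top⟩
  refine ⟨C, ENNReal.mul_ne_top ENNReal.ofReal_ne_top (ENNReal.mul_ne_top ENNReal.ofReal_ne_top hAt),
    fun v hv L hL T s hs hsT hwin y => ?_⟩
  have hT0 : 0 ≤ T := hs.trans hsT
  have ht1 : 0 ≤ T + s := add_nonneg hT0 hs
  have ht2 : 0 ≤ T - s := sub_nonneg.2 hsT
  -- notation
  set θ : ℝ → Space → ℝ≥0∞ := fun t x => fkPartition (N := 1) v L t (fun _ => x) with hθ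
  set Z : ℝ → ℝ≥0∞ := fun t => fkNormSq (N := 1) v L t (fun _ => (1 : ℝ≥0∞)) with hZ
  set M : Set Space := {x : Space | ∀ k, x k ∈ Set.Ioo (L / 4) (3 * L / 4)} with hM
  have hVM : volume M = ENNReal.ofReal (L / 2) ^ 3 := volume_middle L
  have hV0 : volume M ≠ 0 := by
    rw [hVM]; exact pow_ne_zero _ (ENNReal.ofReal_pos.2 (by positivity)).ne'
  have hVt : volume M ≠ ⊤ := by rw [hVM]; exact ENNReal.pow_ne_top ENNReal.ofReal_ne_top
  -- the floor value `W = q₀² |M|` and `L³ = (8/q₀²) W`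
  set W : ℝ≥0∞ := ENNReal.ofReal q ^ 2 * volume M with hW
  have hW0 : W ≠ 0 := mul_ne_zero (pow_ne_zero _ (ENNReal.ofReal_pos.2 hq0).ne') hV0
  have hWt : W ≠ ⊤ := ENNReal.mul_ne_top (ENNReal.pow_ne_top ENNReal.ofReal_ne_top) hVt
  set L3 : ℝ≥0∞ := ENNReal.ofReal (L ^ 3) with hL3
  have hL3W : L3 = ENNReal.ofReal (8 / q ^ 2) * W := by
    rw [hL3, hW, hVM, ← ENNReal.ofReal_pow hq0.le, ← ENNReal.ofReal_pow (by positivity),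
      ← ENNReal.ofReal_mul (by positivity), ← ENNReal.ofReal_mul (by positivity)]
    congr 1
    field_simp
    ring
  -- `Z 0 ≤ L³`
  have hZ0 : Z 0 ≤ L3 := by
    refine (fkNormSq_one_le v le_rfl).trans_eq ?_
    rw [volume_boxN, pow_one, hL3, ENNReal.ofReal_pow hL.le]
  -- the survival floor: `W ≤ Z u` for `0 ≤ u ≤ L²/960`
  have hθm : ∀ u, Measurable (θ u) := fun u => measurable_fkPartition_one hv L u
  have hfloorZ : ∀ u, 0 ≤ u → u ≤ L ^ 2 / 960 → W ≤ Z u := by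
    intro u hu hus
    show W ≤ fkNormSq (N := 1) v L u (fun _ => (1 : ℝ≥0∞))
    rw [fkNormSq_one_config_one v L u]
    calc W = ∫⁻ _ in M, ENNReal.ofReal q ^ 2 := (setLIntegral_const _ _).symm
      _ ≤ ∫⁻ x in M, θ u x ^ 2 :=
          setLIntegral_mono ((hθm u).pow_const 2) fun x hx =>
            pow_le_pow_left' (fkPartition_one_ge_on_middle hv hL hx hu hus) 2
      _ ≤ ∫⁻ x, θ u x ^ 2 := setLIntegral_le_lintegral _ _
  -- the diffusive step `h₀ = L²/1920` and the smoothing constant `κ = (4πh₀)^{-3/2} = (cL)⁻³`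
  set h₀ : ℝ := L ^ 2 / 1920 with hh₀
  have hh0 : 0 < h₀ := by positivity
  have h2h : 2 * h₀ ≤ L ^ 2 / 960 := by rw [hh₀]; linarith
  have hh0s : h₀ ≤ L ^ 2 / 960 := by linarith
  set κ : ℝ≥0∞ := (∏ _i : Fin 1, ∏ _k : Fin 3,
    ENNReal.ofReal (Real.sqrt (2 * Real.pi * (2 * h₀.toNNReal)))⁻¹) with hκ
  have hcL : Real.sqrt (2 * Real.pi * (2 * h₀.toNNReal)) = c * L := by
    rw [Real.coe_toNNReal _ hh0.le, hh₀, hc,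
      show 2 * Real.pi * (2 * (L ^ 2 / 1920)) = Real.pi / 480 * L ^ 2 by ring,
      Real.sqrt_mul (by positivity), Real.sqrt_sq hL.le]
  have hκeq : κ = ENNReal.ofReal ((c * L)⁻¹ ^ 3) := by
    rw [hκ, hcL, Finset.prod_const, Finset.prod_const, Finset.card_univ, Finset.card_univ,
      Fintype.card_fin, Fintype.card_fin, pow_one, ENNReal.ofReal_pow (by positivity)]
  have hκL3 : κ * L3 = P₀ := by
    rw [hκeq, hL3, hP₀, ← ENNReal.ofReal_mul (by positivity)]
    congr 1
    rw [mul_inv, mul_pow, mul_assoc, ← mul_pow, inv_mul_cancel₀ hL.ne', one_pow, mul_one]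
  -- the sup bound at EVERY time: `θ_t(y)² · W ≤ A · Z t`
  have hsup : ∀ t, 0 ≤ t → ∀ x, θ t x ^ 2 * W ≤ A * Z t := by
    intro t ht x
    rcases le_or_gt h₀ t with hle | hlt
    · -- long times: smoothing over one step `h₀` and the ladder
      calc θ t x ^ 2 * W ≤ θ t x ^ 2 * Z (2 * h₀) :=
            mul_le_mul' le_rfl (hfloorZ (2 * h₀) (by positivity) h2h)
        _ ≤ κ * (Z 0 * Z t) := fkSemigroup_one_sq_mul_le (N := 1) hv L hh0 hle _
        _ ≤ κ * (L3 * Z t) := by gcongr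
        _ = P₀ * Z t := by rw [← mul_assoc, hκL3]
        _ ≤ A * Z t := mul_le_mul' le_self_add le_rfl
    · -- short times: `θ ≤ 1` and the floor at `h₀`
      calc θ t x ^ 2 * W ≤ 1 * W :=
            mul_le_mul' (pow_le_one₀ bot_le (fkPartition_le_one v L t _)) le_rfl
        _ = W := one_mul _
        _ ≤ Z h₀ := hfloorZ h₀ hh0.le hh0s
        _ ≤ Z t := fkNormSq_one_antitone (N := 1) hv L ht hlt.le
        _ ≤ A * Z t := le_mul_of_one_le_left bot_le le_add_self
  -- the two times
  have h1 := hsup (T + s) ht1 y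
  have h2 := hsup (T - s) ht2 y
  have hZ1 : Z (T + s) ≤ Z T := fkNormSq_one_antitone (N := 1) hv L hT0 (le_add_of_nonneg_right hs)
  -- the ladder with step `s` (trivial at `s = 0`) and the floor at `2s`
  have hlad : Z (T - s) * Z (2 * s) ≤ Z 0 * Z T := by
    rcases hs.eq_or_lt with h0 | hpos
    · rw [← h0, sub_zero, mul_zero, mul_comm]
    · exact fkNormSq_ladder (N := 1) hv L hpos hsT
  have hZ2 : Z (T - s) * W ≤ L3 * Z T :=
    calc Z (T - s) * W ≤ Z (T - s) * Z (2 * s) :=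
          mul_le_mul' le_rfl (hfloorZ (2 * s) (by positivity) hwin)
      _ ≤ Z 0 * Z T := hlad
      _ ≤ L3 * Z T := mul_le_mul' hZ0 le_rfl
  -- the product, squared, times one more `W`
  have hkey : (θ (T + s) y * θ (T - s) y * W) ^ 2 * W ≤
      (A * A * ENNReal.ofReal (8 / q ^ 2) * Z T ^ 2) * W := by
    calc (θ (T + s) y * θ (T - s) y * W) ^ 2 * W
        = (θ (T + s) y ^ 2 * W) * (θ (T - s) y ^ 2 * W) * W := by ring
      _ ≤ (A * Z (T + s)) * (A * Z (T - s)) * W := mul_le_mul' (mul_le_mul' h1 h2) le_rfl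
      _ = A * A * Z (T + s) * (Z (T - s) * W) := by ring
      _ ≤ A * A * Z T * (L3 * Z T) := mul_le_mul' (mul_le_mul' le_rfl hZ1) hZ2
      _ = (A * A * ENNReal.ofReal (8 / q ^ 2) * Z T ^ 2) * W := by rw [hL3W]; ring
  have h89 : ENNReal.ofReal (8 / q ^ 2) ≤ ENNReal.ofReal (3 / q) ^ 2 := by
    rw [← ENNReal.ofReal_pow (by positivity)]
    refine ENNReal.ofReal_le_ofReal ?_
    rw [div_pow]
    exact div_le_div_of_nonneg_right (by norm_num) (by positivity)
  have hsq : (θ (T + s) y * θ (T - s) y * W) ^ 2 ≤ (A * ENNReal.ofReal (3 / q) * Z T) ^ 2 := by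
    refine ((ENNReal.mul_le_mul_iff_left hW0 hWt).1 hkey).trans ?_
    calc A * A * ENNReal.ofReal (8 / q ^ 2) * Z T ^ 2
        ≤ A * A * ENNReal.ofReal (3 / q) ^ 2 * Z T ^ 2 := by gcongr
      _ = (A * ENNReal.ofReal (3 / q) * Z T) ^ 2 := by ring
  have hlin : θ (T + s) y * θ (T - s) y * W ≤ A * ENNReal.ofReal (3 / q) * Z T :=
    (ENNReal.pow_le_pow_left_iff two_ne_zero).1 hsq
  -- conclude
  calc ENNReal.ofReal (L ^ 3) * (θ (T + s) y * θ (T - s) y)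
      = ENNReal.ofReal (8 / q ^ 2) * (θ (T + s) y * θ (T - s) y * W) := by
        rw [← hL3, hL3W]; ring
    _ ≤ ENNReal.ofReal (8 / q ^ 2) * (A * ENNReal.ofReal (3 / q) * Z T) := mul_le_mul' le_rfl hlin
    _ = C * Z T := by rw [hC]; ring

/-- The same bound with a REAL constant, in the `ENNReal.ofReal C * fkNormSq` shape of the stub
`LocalCrowdingBridge`. [cite: ChungZhao1995, Thm 3.17] -/
theorem fkPartition_one_two_time_mul_le_ofReal : ∃ C : ℝ, 0 < C ∧ ∀ (v : ℝ → ℝ≥0∞), Measurable v →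
    ∀ L : ℝ, 0 < L → ∀ T s : ℝ, 0 ≤ s → s ≤ T → 2 * s ≤ L ^ 2 / 960 → ∀ y : Space,
      ENNReal.ofReal (L ^ 3) * (fkPartition (N := 1) v L (T + s) (fun _ => y) *
          fkPartition (N := 1) v L (T - s) (fun _ => y)) ≤
        ENNReal.ofReal C * fkNormSq (N := 1) v L T (fun _ => (1 : ℝ≥0∞)) := by
  obtain ⟨C, hCt, h⟩ := fkPartition_one_two_time_mul_le
  refine ⟨C.toReal + 1, by positivity, fun v hv L hL T s hs hsT hwin y => ?_⟩
  refine (h v hv L hL T s hs hsT hwin y).trans (mul_le_mul' ?_ le_rfl)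
  calc C = ENNReal.ofReal C.toReal := (ENNReal.ofReal_toReal hCt).symm
    _ ≤ ENNReal.ofReal (C.toReal + 1) := ENNReal.ofReal_le_ofReal (by linarith)

/-- **Toolbox stub `stub_freeOneLineTwoTimeDensity`** (crux stmt-AtomisticToContinuum-9687, line
`tagged-shift-log-harnack`; the free-gas kernel of `stub_localCrowdingBridge`): the one-line two-time
density bound in the `ENNReal.ofReal C * fkNormSq` shape of `LocalCrowdingBridge`
(`= fkPartition_one_two_time_mul_le_ofReal`). -/
theorem stub_freeOneLineTwoTimeDensity :
    ∃ C : ℝ, 0 < C ∧ ∀ (v : ℝ → ℝ≥0∞), Measurable v → ∀ (L : ℝ), 0 < L → ∀ (T s : ℝ), 0 ≤ s → s ≤ T →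
      2 * s ≤ L ^ 2 / 960 → ∀ (y : Space),
        ENNReal.ofReal (L ^ 3) * (fkPartition (N := 1) v L (T + s) (fun _ => y) *
            fkPartition (N := 1) v L (T - s) (fun _ => y)) ≤
          ENNReal.ofReal C * fkNormSq (N := 1) v L T (fun _ => (1 : ℝ≥0∞)) :=
  fkPartition_one_two_time_mul_le_ofReal

end Summit.AtomisticToContinuum.BoseEinsteinCondensation.Cruxes.TwoReplicaTransienceBound.TaggedShiftLogHarnack

end
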